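import Literature.Probability.Percolation.SharpnessDCTProofs
import Literature.Probability.Percolation.PercolationProofs
import Summits.CriticalPhenomena.PercolationContinuityZ3.Theorems.FreeBoxPowerSaving.Negative.FreeBoxPowerSavingStubGuards
import Summits.CriticalPhenomena.PercolationContinuityZ3.Theses.PercShatteringRace

/-!
# Stub `stub_fatFiniteClusters` of line `boundary-interior-split-fat-finite-clusters`
# (crux `PercNonProliferation.FreeBoxPowerSaving`, stmt-CriticalPhenomena-4447): conditional closing

Supports (does not close) the crux `PercNonProliferation.FreeBoxPowerSaving`.  The registered stub

  `stub_fatFiniteClusters : ∃ a C : ℝ, 0 < a ∧ ∀ n ≥ 1,`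
  `  Σ_{y ∈ B(2n)} P_{p_c}(0 ↔ y, C(0) ⊆ B(2n)) ≤ C · n^{3-a}`

says that the CONFINED VOLUME `CV(2n) = E_{p_c}[|C(0)| ; C(0) ⊆ Λ_{2n}]` of critical bond
percolation on `ℤ³` has a power saving against the trivial bound `|Λ_{2n}| ≤ 125 n³`.  As an
unconditional statement it is open: no upper bound WITH A RATE on the volume of finite critical
clusters is known on `ℤ³` (the tree's rate-carrying tools are two-arm — Hutchcroft's two-ghost
inequality `TwoGhostInequalityProofs.lean` — or relative to the typical value —
`UniversalTightness.lean` — or high-dimensional — `MeanFieldDelta.lean`).  This file kernel-checks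
the cheapest conditional closing, from the sibling crux
`PercShatteringRace.FreeSusceptibilityPowerSaving` (stmt-CriticalPhenomena-5786,
`Σ_{y ∈ Λ_R} P_{p_c}(0 ↔ y in Λ_R) ≤ C R^{5/2}`):

* `FatFiniteClusters.confinedVolume_le_freeVolume` — `CV(m) ≤ Σ_{y ∈ Λ_m} P(0 ↔ y in Λ_m)` at every
  `p`: a cluster confined to the box joins its points inside the box
  (`FreeBoxPowerSavingNegative.openConn_inter_confined_subset_openConnIn`);
* `FatFiniteClusters.confinedVolume_le_of_centreRootedBound` — a centre-rooted free-box bound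
  `Σ_{y ∈ Λ_R} P_{p_c}(0 ↔ y in Λ_R) ≤ C R^b` (`R ≥ 1`) gives `CV(2n) ≤ max(C,0) · 2^b · n^b` (`n ≥ 1`);
* `stub_fatFiniteClusters_of_freeSusceptibilityPowerSaving` — **stmt-5786 ⟹ the stub VERBATIM**,
  with `a = 1/2` (`b = 5/2 = 3 - 1/2`).
-/

namespace Summit.CriticalPhenomena.PercolationContinuityZ3.FreeBoxPowerSavingLine

open MeasureTheory Literature.Probability.Percolation Literature.Probability.LatticeModels
open scoped Classical

noncomputable section

namespace FatFiniteClusters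

/-- **Confined volume ≤ free volume.**  For every `p` and every box `Λ_m = box 3 m`,
`Σ_{y ∈ Λ_m} P_p(0 ↔ y, C(0) ⊆ Λ_m) ≤ Σ_{y ∈ Λ_m} P_p(0 ↔ y in Λ_m)`: a cluster confined to `Λ_m`
joins `0` to `y` inside `Λ_m` (`openConn_inter_confined_subset_openConnIn`), termwise. -/
theorem confinedVolume_le_freeVolume (p : unitInterval) (m : ℕ) :
    ∑ y ∈ box 3 m, (bondPercolation (zdGraph 3) p).real
        (openConn 0 y ∩ {ω | openCluster ω 0 ⊆ ↑(box 3 m)})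
      ≤ ∑ y ∈ box 3 m, (bondPercolation (zdGraph 3) p).real
        (openConnIn (↑(box 3 m) : Set (Site 3)) 0 y) :=
  Finset.sum_le_sum fun y _ =>
    measureReal_mono (FreeBoxPowerSavingNegative.openConn_inter_confined_subset_openConnIn _ y)
      (measure_ne_top _ _)

/-- **A centre-rooted free-box bound controls the confined volume of the double box.**  If
`Σ_{y ∈ Λ_R} P_{p_c}(0 ↔ y in Λ_R) ≤ C R^b` for all `R ≥ 1`, then for `n ≥ 1`
`CV(2n) = Σ_{y ∈ Λ_{2n}} P_{p_c}(0 ↔ y, C(0) ⊆ Λ_{2n}) ≤ max(C,0) · 2^b · n^b`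
(confined ≤ free at `R = 2n`, and `(2n)^b = 2^b n^b`). -/
theorem confinedVolume_le_of_centreRootedBound {b C : ℝ}
    (hC : ∀ R : ℕ, 1 ≤ R →
      ∑ y ∈ box 3 R, (bondPercolation (zdGraph 3) (criticalProbI 3)).real
          (openConnIn (↑(box 3 R) : Set (Site 3)) 0 y) ≤ C * (R : ℝ) ^ b)
    {n : ℕ} (hn : 1 ≤ n) :
    ∑ y ∈ box 3 (2 * n), (bondPercolation (zdGraph 3) (criticalProbI 3)).real
        (openConn 0 y ∩ {ω | openCluster ω 0 ⊆ ↑(box 3 (2 * n))})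
      ≤ max C 0 * (2 : ℝ) ^ b * (n : ℝ) ^ b := by
  have hnpos : (0 : ℝ) < n := by exact_mod_cast hn
  have h2n : 1 ≤ 2 * n := by omega
  have h2 : ((2 * n : ℕ) : ℝ) ^ b = (2 : ℝ) ^ b * (n : ℝ) ^ b := by
    push_cast
    exact Real.mul_rpow (by norm_num) hnpos.le
  calc ∑ y ∈ box 3 (2 * n), (bondPercolation (zdGraph 3) (criticalProbI 3)).real
          (openConn 0 y ∩ {ω | openCluster ω 0 ⊆ ↑(box 3 (2 * n))})
      ≤ ∑ y ∈ box 3 (2 * n), (bondPercolation (zdGraph 3) (criticalProbI 3)).real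
          (openConnIn (↑(box 3 (2 * n)) : Set (Site 3)) 0 y) :=
        confinedVolume_le_freeVolume (criticalProbI 3) (2 * n)
    _ ≤ C * ((2 * n : ℕ) : ℝ) ^ b := hC (2 * n) h2n
    _ ≤ max C 0 * ((2 * n : ℕ) : ℝ) ^ b :=
        mul_le_mul_of_nonneg_right (le_max_left _ _) (Real.rpow_nonneg (by positivity) _)
    _ = max C 0 * (2 : ℝ) ^ b * (n : ℝ) ^ b := by rw [h2, mul_assoc]

end FatFiniteClusters

/-- **stmt-CriticalPhenomena-5786 ⟹ `stub_fatFiniteClusters`** (conclusion = the registered stub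
verbatim).  The sibling crux `PercShatteringRace.FreeSusceptibilityPowerSaving`,
`Σ_{y ∈ Λ_R} P_{p_c}(0 ↔ y in Λ_R) ≤ C R^{5/2}` for `R ≥ 1`, bounds the confined volume by
`Σ_{y ∈ Λ_{2n}} P_{p_c}(0 ↔ y, C(0) ⊆ Λ_{2n}) ≤ Σ_{y ∈ Λ_{2n}} P_{p_c}(0 ↔ y in Λ_{2n}) ≤ C (2n)^{5/2}
= (C 2^{5/2}) · n^{3 - 1/2}`, i.e. the stub holds with `a = 1/2` and constant `max(C,0) · 2^{5/2}`. -/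
theorem stub_fatFiniteClusters_of_freeSusceptibilityPowerSaving :
    Summit.CriticalPhenomena.PercolationContinuityZ3.Theses.PercShatteringRace.FreeSusceptibilityPowerSaving →
    ∃ a C : ℝ, 0 < a ∧ ∀ n : ℕ, 1 ≤ n →
      ∑ y ∈ box 3 (2 * n), (bondPercolation (zdGraph 3) (criticalProbI 3)).real
          (openConn 0 y ∩ {ω | openCluster ω 0 ⊆ ↑(box 3 (2 * n))})
        ≤ C * (n : ℝ) ^ (3 - a) := by
  rintro ⟨C, hC⟩
  refine ⟨1 / 2, max C 0 * (2 : ℝ) ^ ((5 : ℝ) / 2), by norm_num, fun n hn => ?_⟩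
  have e : (3 : ℝ) - 1 / 2 = (5 : ℝ) / 2 := by norm_num
  rw [e]
  exact FatFiniteClusters.confinedVolume_le_of_centreRootedBound hC hn

end

end Summit.CriticalPhenomena.PercolationContinuityZ3.FreeBoxPowerSavingLine
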